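import Literature.MathematicalPhysics.QuantumFieldTheory.Balaban1983to89.T3AlphaInputsACTwoRunLevel
import Literature.MathematicalPhysics.QuantumFieldTheory.Balaban1983to89.T3Thresholds

/-!
# Crux-ideate sketch g7 (ideator 1, stmt-QuantumFields-19201 / live twin stmt-QuantumFields-19935) — card 7 «rate-locality-interpolation»

RATE–LOCALITY INTERPOLATION FOR THE TWO-CUTOFF ROW.  The unprinted conjunct of `TwoRunMin` / `TwoRunMinT` is the per-polymer two-run comparison
`PolymerCauchyMinAt(T) D … κ₁ a C` ([King1986] Props 3.8–3.9 read for Bałaban's (43)-terms; located, unprinted for non-abelian d = 3): a bound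
`C·e^{−κ₁𝓛(Y)}·θ(n)²·L^{−4(k−i)}·(L^{−i})^{a}` on the shifted difference of the MATCHED terms of runs `K`, `K+1`.  The consumer
(`landed_levelCauchyOfTwoRunMin`, S-E″ by pure counting) takes ANY `a > 0` and ANY `κ₁ > 0` at which `LocCover D κ₁ C'` holds — and print's size row (44)–(45)
holds at a decay rate `κ` that is LARGE (as large as we please with the block size `M`, [Balaban1985UV3] (45)–(46) p.267, [Balaban1984UV2] §3), while `LocCover` only
needs `κ₁` above a lattice-animal constant.  The elementary squeeze `x ≤ min(A, B) ≤ A^{1−s}B^{s}` then TRADES the surplus decay of the size row for the rate of a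
comparison row that has NO decay at all — even exponential GROWTH `e^{+p𝓛(Y)}` in the tree length is admissible:

  `PairSizeT(κ, C_A) ∧ PolymerCauchyMinAtT(κ₀, b, C_B) ⟹ PolymerCauchyMinAtT((1−s)κ + sκ₀, s·b, (4C_A)^{1−s}(2C_B)^{s})`   (`κ₀ ≤ 0` allowed, `0 ≤ s ≤ 1`),

with the new shift `c̃ K n j Y :=` the two-run difference at the UNIT datum `V = 1` (which lies in every window `PlaqSmall θ(n)`, `θ(n) > 0`).  So the prover of the
unprinted comparison may IGNORE LOCALITY: compare the two runs' terms constituent by constituent (random-walk / R-operation pieces, minimiser pieces) in plain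
sup/operator norms at relative precision `(L^{−i})^{b}`, paying the NUMBER of constituents (`≤ e^{p𝓛(Y)}`) instead of re-deriving tree decay for the difference
(King p.665 «we must re-analyse the degrees of subgraphs» is exactly the step that disappears).  Everything below is sorry-free bookkeeping over the tree's schemas;
nothing is asserted about Bałaban's objects.

* §1 `squeeze_rpow`, `squeeze_product`, `exp_interpolate` — the Hölder squeeze; `kernel_squeeze` — the same lever for kernel entries (the prover's tool).
* §2 `PairSizeT` (the size row for the matched pair, K-run tree length, window `θ(n)`), `TreeLenMatched` (refinement-invariance of `𝓛` on matched domains),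
  `pairSizeT_of_termSizeTrivT` (PairSizeT ⇐ TermSizeTrivT ∧ LocMatched ∧ TreeLenMatched ∧ θ antitone).
* §3 `unitDiff`, `plaqSmall_one`, `polymerCauchyMinAtT_squeeze` — THE INTERPOLATION THEOREM; `polymerCauchyMinAt_squeeze` (the §3-schema instance).
* §4 `termSizeTrivT_mono` (the size row survives lowering `κ`), `twoRunMinT_of_sloppy` / `twoRunMin_of_sloppy` — the folded bundle from print's rows at rate `κ`,
  `LocCover` at the LOWERED rate, and a decay-free comparison.
* §5 `polymerCauchyMinAtT_of_constituents` — the prover's entry point: a decay-free row at rate `−p` from per-constituent decay-free comparisons and a constituent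
  COUNT `#S(Y) ≤ e^{p𝓛(Y)}` (refinement-matched labels).

References: T. Bałaban, CMP 102 (1985) 255–275 [Balaban1985UV3] ((43)–(46) pp.266–267); C. King, CMP 102 (1986) 649–677 [King1986] (Props 3.8–3.9 pp.664–665, p.675);
D. Brydges, «A short course on cluster expansions», Les Houches 1984 (trading decay for smallness in polymer activities).
-/

set_option autoImplicit false

noncomputable section

open Literature.MathematicalPhysics.QuantumFieldTheory.Balaban1983to89
open Literature.MathematicalPhysics.QuantumFieldTheory.Balaban1983to89.T3ContinuumYM3Torus
open Literature.MathematicalPhysics.QuantumFieldTheory.Balaban1983to89.T3UnitScaleTilt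
open Literature.MathematicalPhysics.QuantumFieldTheory.Balaban1983to89.T3LevelShift
open Literature.MathematicalPhysics.QuantumFieldTheory.Balaban1983to89.T3AlphaInputsAC
open Literature.MathematicalPhysics.QuantumFieldTheory.Balaban1983to89.T3AlphaPolymerSocket
open Literature.MathematicalPhysics.QuantumFieldTheory.Balaban1983to89.T3AlphaInputsACTwoRun
open Literature.MathematicalPhysics.QuantumFieldTheory.Balaban1983to89.T3AlphaInputsACTwoRunLevel

namespace Summit.QuantumFields.YangMills.Cruxes.FluctuationComparisonRegPr.Ideate1Squeeze

/-! ## §1 The Hölder squeeze `x ≤ min(A,B) ≤ A^{1−s}·B^{s}` -/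

/-- `0 ≤ x ≤ A`, `x ≤ B`, `0 ≤ s ≤ 1` ⟹ `x ≤ A^{1−s}·B^{s}`. -/
theorem squeeze_rpow {x A B s : ℝ} (hx : 0 ≤ x) (hA : x ≤ A) (hB : x ≤ B) (hs0 : 0 ≤ s) (hs1 : s ≤ 1) :
    x ≤ A ^ (1 - s) * B ^ s := by
  have hA0 : 0 ≤ A := hx.trans hA
  have h1 : x ^ (1 - s) ≤ A ^ (1 - s) := Real.rpow_le_rpow hx hA (by linarith)
  have h2 : x ^ s ≤ B ^ s := Real.rpow_le_rpow hx hB hs0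
  calc x = x ^ ((1 - s) + s) := by simp
    _ = x ^ (1 - s) * x ^ s := Real.rpow_add' hx (by norm_num)
    _ ≤ A ^ (1 - s) * B ^ s := mul_le_mul h1 h2 (Real.rpow_nonneg hx _) (Real.rpow_nonneg hA0 _)

/-- The squeeze in product form: a decaying bound `c₁E₁M` without rate and a rated bound `c₂E₂MR` without decay give `c₁^{1−s}c₂^{s}·E₁^{1−s}E₂^{s}·M·R^{s}`. -/
theorem squeeze_product {x c₁ c₂ E₁ E₂ M R s : ℝ} (hx : 0 ≤ x) (hc₁ : 0 ≤ c₁) (hc₂ : 0 ≤ c₂) (hE₁ : 0 ≤ E₁)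
    (hE₂ : 0 ≤ E₂) (hM : 0 ≤ M) (hR : 0 ≤ R) (hs0 : 0 ≤ s) (hs1 : s ≤ 1) (h₁ : x ≤ c₁ * E₁ * M)
    (h₂ : x ≤ c₂ * E₂ * M * R) :
    x ≤ (c₁ ^ (1 - s) * c₂ ^ s) * (E₁ ^ (1 - s) * E₂ ^ s) * M * R ^ s := by
  have h := squeeze_rpow hx h₁ h₂ hs0 hs1
  rw [Real.mul_rpow (mul_nonneg hc₁ hE₁) hM, Real.mul_rpow hc₁ hE₁,
    Real.mul_rpow (mul_nonneg (mul_nonneg hc₂ hE₂) hM) hR, Real.mul_rpow (mul_nonneg hc₂ hE₂) hM,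
    Real.mul_rpow hc₂ hE₂] at h
  have hMM : M ^ (1 - s) * M ^ s = M := by
    rw [← Real.rpow_add' hM (by norm_num : (1 - s) + s ≠ 0)]; simp
  calc x ≤ _ := h
    _ = (c₁ ^ (1 - s) * c₂ ^ s) * (E₁ ^ (1 - s) * E₂ ^ s) * (M ^ (1 - s) * M ^ s) * R ^ s := by ring
    _ = (c₁ ^ (1 - s) * c₂ ^ s) * (E₁ ^ (1 - s) * E₂ ^ s) * M * R ^ s := by rw [hMM]

/-- Two exponentials interpolate to the exponential of the interpolated rate: `(e^{−κ𝓛})^{1−s}(e^{−κ₀𝓛})^{s} = e^{−((1−s)κ+sκ₀)𝓛}`. -/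
theorem exp_interpolate (κ κ₀ s ℓ : ℝ) :
    Real.exp (-κ * ℓ) ^ (1 - s) * Real.exp (-κ₀ * ℓ) ^ s = Real.exp (-((1 - s) * κ + s * κ₀) * ℓ) := by
  rw [← Real.exp_mul, ← Real.exp_mul, ← Real.exp_add]
  congr 1; ring

/-- **KERNEL-LEVEL SQUEEZE** (the same lever one level down, for the prover of the decay-free row): two kernel entries each of printed size
`C·e^{−δd}` whose difference is `≤ B` with NO decay information (e.g. a two-grid operator-norm rate) differ by at most `(2C)^{1−s}·B^{s}·e^{−(1−s)δd}` —
the «rate × reduced decay» shape of [King1986] Prop. 3.9 (3.74) without interpolating resolvents. [cite: King1986, Prop. 3.9 (3.74) p.665] -/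
theorem kernel_squeeze {a b C B δ d s : ℝ} (hC : 0 ≤ C) (hs0 : 0 ≤ s) (hs1 : s ≤ 1)
    (ha : |a| ≤ C * Real.exp (-δ * d)) (hb : |b| ≤ C * Real.exp (-δ * d)) (hab : |a - b| ≤ B) :
    |a - b| ≤ (2 * C) ^ (1 - s) * B ^ s * Real.exp (-((1 - s) * δ) * d) := by
  have h1 : |a - b| ≤ 2 * C * Real.exp (-δ * d) :=
    calc |a - b| ≤ |a| + |b| := abs_sub _ _
      _ ≤ C * Real.exp (-δ * d) + C * Real.exp (-δ * d) := add_le_add ha hb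
      _ = 2 * C * Real.exp (-δ * d) := by ring
  have key := squeeze_rpow (abs_nonneg _) h1 hab hs0 hs1
  rw [Real.mul_rpow (by positivity) (Real.exp_nonneg _), ← Real.exp_mul] at key
  calc |a - b| ≤ _ := key
    _ = (2 * C) ^ (1 - s) * B ^ s * Real.exp (-δ * d * (1 - s)) := by ring
    _ = (2 * C) ^ (1 - s) * B ^ s * Real.exp (-((1 - s) * δ) * d) := by
        rw [show -δ * d * (1 - s) = -((1 - s) * δ) * d by ring]

variable {F : T3Family} {γ : ℝ}

/-! ## §2 The size row for the matched pair, and its derivation from print's size row -/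

/-- **SIZE OF THE MATCHED PAIR** (hypothesis schema, never asserted): on the window `PlaqSmall θ(n)`, both the run-`K+1` term of `refineSet Y` (level `i+1`) and the
run-`K` term of `Y` (level `i = 1+j`) are bounded by `C·e^{−κ𝓛_K(Y)}·θ(n)²·L^{−4(k−i)}` — print's (44)–(45) for the two runs, read with the run-`K` tree length of
`Y` (refinement-invariant, `TreeLenMatched`) and the window threshold `θ(n) ≥ θ(n+1)`. [cite: Balaban1985UV3, (44)-(45) p.267] -/
def PairSizeT (D : AlphaDataT3 F γ) (PT : TermFn F) (b₀ p₀ κ C : ℝ) : Prop :=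
  ∀ (K n : ℕ) (h : n ≤ K), ∀ j : ℕ, j < K - n →
    ∀ V : GaugeField (F.P n) 0 (Matrix.specialUnitaryGroup (Fin 2) ℂ), PlaqSmall (θBal F.L γ b₀ p₀ n) V →
      ∀ Y ∈ D.Loc K (K - n) (D.triv K (K - n)) (1 + j),
        |PT (K + 1) (K + 1 - n) (1 + (j + 1)) (refineSet F K Y)
            (fieldShift (F.sitesPerDir_eq (m := F.m) (K := K + 1) (j := K + 1 - n) (m' := F.m) (K' := n) (j' := 0) (by omega)) V)| ≤
          C * Real.exp (-κ * D.treeLen K (1 + j) Y) * θBal F.L γ b₀ p₀ n ^ 2 * (((F.L : ℝ) ^ (K - n - 1 - j))⁻¹) ^ 4 ∧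
        |PT K (K - n) (1 + j) Y
            (fieldShift (F.sitesPerDir_eq (m := F.m) (K := K) (j := K - n) (m' := F.m) (K' := n) (j' := 0) (by omega)) V)| ≤
          C * Real.exp (-κ * D.treeLen K (1 + j) Y) * θBal F.L γ b₀ p₀ n ^ 2 * (((F.L : ℝ) ^ (K - n - 1 - j))⁻¹) ^ 4

/-- **REFINEMENT-INVARIANCE OF THE TREE LENGTH ON MATCHED DOMAINS** (hypothesis schema, never asserted): the tree length of a level-`(i+1)` domain of run `K+1`
that is the refinement of a level-`i` domain `Y` of run `K` equals that of `Y` — both are measured in units of the domain's own scale `L^{i}ξ` ((45) p.267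
«d_j(Y) … in the L^{j}ξ-scale»). [cite: Balaban1985UV3, (45) p.267] -/
def TreeLenMatched (D : AlphaDataT3 F γ) : Prop :=
  ∀ (K i : ℕ) (Y : Set (Site (F.P K) 0)), D.treeLen (K + 1) (i + 1) (refineSet F K Y) = D.treeLen K i Y

/-- `PairSizeT` from print's size row `TermSizeTrivT` (at BOTH cut-offs), matched domains, refinement-invariant tree length and the threshold monotonicity
`θ(n+1) ≤ θ(n)` (tree: `T3Thresholds.θBal_succ_le` on the window `√γ ≤ e^{1−p₀}`). [cite: Balaban1985UV3, (44)-(45) p.267] -/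
theorem pairSizeT_of_termSizeTrivT {D : AlphaDataT3 F γ} {PT : TermFn F} {b₀ p₀ C κ : ℝ} (hC : 0 ≤ C)
    (hT : TermSizeTrivT D PT b₀ p₀ C κ) (hM : LocMatched D) (hℓ : TreeLenMatched D)
    (hθ0 : ∀ n, 0 ≤ θBal F.L γ b₀ p₀ (n + 1)) (hθ : ∀ n, θBal F.L γ b₀ p₀ (n + 1) ≤ θBal F.L γ b₀ p₀ n) :
    PairSizeT D PT b₀ p₀ κ C := by
  intro K n h j hj V hV Y hY
  have hθ2 : θBal F.L γ b₀ p₀ (n + 1) ^ 2 ≤ θBal F.L γ b₀ p₀ n ^ 2 := pow_le_pow_left₀ (hθ0 n) (hθ n) 2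
  constructor
  · have hY' : refineSet F K Y ∈ D.Loc (K + 1) (K + 1 - n) (D.triv (K + 1) (K + 1 - n)) (1 + j + 1) :=
      (hM K n h (1 + j) (by omega) (by omega)).mapsTo (Finset.mem_coe.mpr hY)
    have hsz := hT.2 (K + 1) n (by omega) V hV (1 + j + 1) (by omega) (by omega) (refineSet F K Y) hY'
    rw [hℓ K (1 + j) Y, show K + 1 - n - (1 + j + 1) = K - n - 1 - j by omega] at hsz
    refine hsz.trans ?_
    have hE : 0 ≤ C * Real.exp (-κ * D.treeLen K (1 + j) Y) := mul_nonneg hC (Real.exp_nonneg _)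
    have hP : 0 ≤ (((F.L : ℝ) ^ (K - n - 1 - j))⁻¹) ^ 4 := by positivity
    exact mul_le_mul_of_nonneg_right (mul_le_mul_of_nonneg_left hθ2 hE) hP
  · have hsz := hT.2 K n h V hV (1 + j) (by omega) (by omega) Y hY
    rw [show K - n - (1 + j) = K - n - 1 - j by omega] at hsz
    refine hsz.trans ?_
    have hE : 0 ≤ C * Real.exp (-κ * D.treeLen K (1 + j) Y) := mul_nonneg hC (Real.exp_nonneg _)
    have hP : 0 ≤ (((F.L : ℝ) ^ (K - n - 1 - j))⁻¹) ^ 4 := by positivity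
    exact mul_le_mul_of_nonneg_right (mul_le_mul_of_nonneg_left hθ2 hE) hP

/-! ## §3 The interpolation theorem -/

/-- The unit configuration lies in every positive small-plaquette window (cf. tree `B15Claim189PinNonVacuity.one_mem_plaqSmall`, outside this import cone).
[cite: Balaban1988Convergent, (2.12) p.256] -/
theorem plaqSmall_one (n : ℕ) {θ : ℝ} (hθ : 0 < θ) :
    PlaqSmall θ (1 : GaugeField (F.P n) 0 (Matrix.specialUnitaryGroup (Fin 2) ℂ)) := by
  intro p
  have h1 : GaugeField.plaqHol (1 : GaugeField (F.P n) 0 (Matrix.specialUnitaryGroup (Fin 2) ℂ)) p = 1 := by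
    simp [GaugeField.plaqHol, show ∀ b : PBond (F.P n) 0,
      (1 : GaugeField (F.P n) 0 (Matrix.specialUnitaryGroup (Fin 2) ℂ)) b = 1 from fun _ => rfl]
  rw [h1, GaugeGroup.dist1_one]
  exact hθ

open Classical in
/-- **THE CANONICAL SHIFT**: the two-run difference of the matched terms at the UNIT datum `V = 1` (`0` off the range `n ≤ K`). [cite: King1986, Prop. 3.9 (3.74) p.665] -/
def unitDiff (PT : TermFn F) (K n j : ℕ) (Y : Set (Site (F.P K) 0)) : ℝ :=
  if h : n ≤ K then
    PT (K + 1) (K + 1 - n) (1 + (j + 1)) (refineSet F K Y)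
        (fieldShift (F.sitesPerDir_eq (m := F.m) (K := K + 1) (j := K + 1 - n) (m' := F.m) (K' := n) (j' := 0) (by omega)) 1) -
      PT K (K - n) (1 + j) Y
        (fieldShift (F.sitesPerDir_eq (m := F.m) (K := K) (j := K - n) (m' := F.m) (K' := n) (j' := 0) (by omega)) 1)
  else 0

/-- **RATE–LOCALITY INTERPOLATION** (sorry-free): the size row for the matched pair at decay rate `κ` and a two-run comparison row at ANY rate `κ₀` (`κ₀ ≤ 0`:
no decay, growth `e^{|κ₀|𝓛}` allowed) with exponent `b` give the two-run comparison row at decay rate `(1−s)κ + sκ₀` and exponent `s·b`, constant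
`(4C_A)^{1−s}(2C_B)^{s}`, shift = the difference at the unit datum.  [cite: King1986, Prop. 3.8-3.9 (3.71)-(3.74) pp.664-665; Balaban1985UV3, (44)-(45) p.267] -/
theorem polymerCauchyMinAtT_squeeze {D : AlphaDataT3 F γ} {PT : TermFn F} {b₀ p₀ κ κ₀ b C_A C_B s : ℝ}
    (hs0 : 0 ≤ s) (hs1 : s ≤ 1) (hCA : 0 ≤ C_A) (hCB : 0 ≤ C_B) (hθ : ∀ n, 0 < θBal F.L γ b₀ p₀ n)
    (hA : PairSizeT D PT b₀ p₀ κ C_A) (hB : PolymerCauchyMinAtT D PT b₀ p₀ κ₀ b C_B) :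
    PolymerCauchyMinAtT D PT b₀ p₀ ((1 - s) * κ + s * κ₀) (s * b) ((4 * C_A) ^ (1 - s) * (2 * C_B) ^ s) := by
  obtain ⟨c, hc⟩ := hB
  refine ⟨unitDiff PT, ?_⟩
  intro K n h j hj V hV Y hY
  have h1 := plaqSmall_one (F := F) n (hθ n)
  -- the four printed bounds in play
  have hBV := hc K n h j hj V hV Y hY
  have hB1 := hc K n h j hj 1 h1 Y hY
  obtain ⟨hA1V, hA0V⟩ := hA K n h j hj V hV Y hY
  obtain ⟨hA11, hA01⟩ := hA K n h j hj 1 h1 Y hY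
  -- abbreviations
  set ℓ := D.treeLen K (1 + j) Y with hℓ
  set T := θBal F.L γ b₀ p₀ n ^ 2 with hT
  set P := (((F.L : ℝ) ^ (K - n - 1 - j))⁻¹) ^ 4 with hP
  set R := ((F.L : ℝ) ^ (1 + j))⁻¹ with hR
  set a₁ := PT (K + 1) (K + 1 - n) (1 + (j + 1)) (refineSet F K Y)
      (fieldShift (F.sitesPerDir_eq (m := F.m) (K := K + 1) (j := K + 1 - n) (m' := F.m) (K' := n) (j' := 0) (by omega)) V) with ha₁
  set a₀ := PT K (K - n) (1 + j) Y
      (fieldShift (F.sitesPerDir_eq (m := F.m) (K := K) (j := K - n) (m' := F.m) (K' := n) (j' := 0) (by omega)) V) with ha₀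
  set u₁ := PT (K + 1) (K + 1 - n) (1 + (j + 1)) (refineSet F K Y)
      (fieldShift (F.sitesPerDir_eq (m := F.m) (K := K + 1) (j := K + 1 - n) (m' := F.m) (K' := n) (j' := 0) (by omega)) 1) with hu₁
  set u₀ := PT K (K - n) (1 + j) Y
      (fieldShift (F.sitesPerDir_eq (m := F.m) (K := K) (j := K - n) (m' := F.m) (K' := n) (j' := 0) (by omega)) 1) with hu₀
  have hunit : unitDiff PT K n j Y = u₁ - u₀ := by
    simp only [unitDiff, dif_pos h, hu₁, hu₀]
  rw [hunit]
  have hT0 : 0 ≤ T := by positivity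
  have hP0 : 0 ≤ P := by positivity
  have hR0 : 0 ≤ R := by positivity
  -- A: no rate, decay κ (print's size row for the four terms)
  have hx4 : |a₁ - a₀ - (u₁ - u₀)| ≤ 4 * C_A * Real.exp (-κ * ℓ) * (T * P) :=
    calc |a₁ - a₀ - (u₁ - u₀)| ≤ |a₁ - a₀| + |u₁ - u₀| := abs_sub _ _
      _ ≤ (|a₁| + |a₀|) + (|u₁| + |u₀|) := add_le_add (abs_sub _ _) (abs_sub _ _)
      _ ≤ (C_A * Real.exp (-κ * ℓ) * T * P + C_A * Real.exp (-κ * ℓ) * T * P) +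
            (C_A * Real.exp (-κ * ℓ) * T * P + C_A * Real.exp (-κ * ℓ) * T * P) :=
          add_le_add (add_le_add hA1V hA0V) (add_le_add hA11 hA01)
      _ = 4 * C_A * Real.exp (-κ * ℓ) * (T * P) := by ring
  -- B: rate b, decay κ₀ (possibly none): re-shift from `c` to the unit-datum difference
  have hx2 : |a₁ - a₀ - (u₁ - u₀)| ≤ 2 * C_B * Real.exp (-κ₀ * ℓ) * (T * P) * R ^ b := by
    have e : a₁ - a₀ - (u₁ - u₀) = (a₁ - a₀ - c K n j Y) - (u₁ - u₀ - c K n j Y) := by ring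
    rw [e]
    calc |a₁ - a₀ - c K n j Y - (u₁ - u₀ - c K n j Y)|
          ≤ |a₁ - a₀ - c K n j Y| + |u₁ - u₀ - c K n j Y| := abs_sub _ _
      _ ≤ C_B * Real.exp (-κ₀ * ℓ) * T * P * R ^ b + C_B * Real.exp (-κ₀ * ℓ) * T * P * R ^ b := add_le_add hBV hB1
      _ = 2 * C_B * Real.exp (-κ₀ * ℓ) * (T * P) * R ^ b := by ring
  have key := squeeze_product (abs_nonneg _) (by positivity) (by positivity) (Real.exp_nonneg _) (Real.exp_nonneg _)
    (mul_nonneg hT0 hP0) (Real.rpow_nonneg hR0 b) hs0 hs1 hx4 hx2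
  rw [exp_interpolate, ← Real.rpow_mul hR0, mul_comm b s] at key
  calc |a₁ - a₀ - (u₁ - u₀)| ≤ _ := key
    _ = (4 * C_A) ^ (1 - s) * (2 * C_B) ^ s * Real.exp (-((1 - s) * κ + s * κ₀) * ℓ) * T * P * R ^ (s * b) := by ring

/-- The §3-schema instance (`PT := ptermMin D`, definitional): `PairSizeT D (ptermMin D) … κ C_A ∧ PolymerCauchyMinAt D … κ₀ b C_B ⟹ PolymerCauchyMinAt D …
((1−s)κ + sκ₀) (s·b) ((4C_A)^{1−s}(2C_B)^{s})`. [cite: King1986, Prop. 3.8-3.9 (3.71)-(3.74) pp.664-665] -/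
theorem polymerCauchyMinAt_squeeze {D : AlphaDataT3 F γ} {b₀ p₀ κ κ₀ b C_A C_B s : ℝ}
    (hs0 : 0 ≤ s) (hs1 : s ≤ 1) (hCA : 0 ≤ C_A) (hCB : 0 ≤ C_B) (hθ : ∀ n, 0 < θBal F.L γ b₀ p₀ n)
    (hA : PairSizeT D (ptermMin D) b₀ p₀ κ C_A) (hB : PolymerCauchyMinAt D b₀ p₀ κ₀ b C_B) :
    PolymerCauchyMinAt D b₀ p₀ ((1 - s) * κ + s * κ₀) (s * b) ((4 * C_A) ^ (1 - s) * (2 * C_B) ^ s) :=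
  (polymerCauchyMinAtT_ptermMin_iff D b₀ p₀ _ _ _).mp
    (polymerCauchyMinAtT_squeeze hs0 hs1 hCA hCB hθ hA ((polymerCauchyMinAtT_ptermMin_iff D b₀ p₀ κ₀ b C_B).mpr hB))

/-! ## §4 The folded bundle from print's rows at rate `κ`, `LocCover` at the lowered rate, and a decay-free comparison -/

/-- The size row survives LOWERING the decay rate (`0 < κ' ≤ κ`, non-negative tree lengths, `C ≥ 0`). [cite: Balaban1985UV3, (44)-(45) p.267] -/
theorem termSizeTrivT_mono {D : AlphaDataT3 F γ} {PT : TermFn F} {b₀ p₀ C κ κ' : ℝ} (hC : 0 ≤ C)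
    (hT : TermSizeTrivT D PT b₀ p₀ C κ) (hκ' : 0 < κ') (hle : κ' ≤ κ) (hℓ : ∀ K i Y, 0 ≤ D.treeLen K i Y) :
    TermSizeTrivT D PT b₀ p₀ C κ' := by
  refine ⟨hκ', fun K n h V hV i hi hiK Y hY => (hT.2 K n h V hV i hi hiK Y hY).trans ?_⟩
  have hexp : Real.exp (-κ * D.treeLen K i Y) ≤ Real.exp (-κ' * D.treeLen K i Y) :=
    Real.exp_le_exp.mpr (by nlinarith [hℓ K i Y])
  have h4 : 0 ≤ (((F.L : ℝ) ^ (K - n - i))⁻¹) ^ 4 := by positivity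
  have h2 : 0 ≤ θBal F.L γ b₀ p₀ (n + 1) ^ 2 := by positivity
  exact mul_le_mul_of_nonneg_right (mul_le_mul_of_nonneg_right (mul_le_mul_of_nonneg_left hexp hC) h2) h4

/-- **`TwoRunMinT` FROM A DECAY-FREE COMPARISON** (sorry-free assembly): print's size row at rate `κ` (with the matched-pair reading `PairSizeT`), the geometric
clauses with `LocCover` at the LOWERED rate `κ' = (1−s)κ + sκ₀ ∈ (0, κ]`, and a two-run comparison at rate `κ₀` (any sign) with exponent `b` give the folded
bundle with exponent `s·b`.  With `0 < s` and `0 < b` the consumer `landed_levelCauchyOfTwoRunMin(T)` takes it from there.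
[cite: Balaban1985UV3, (43)-(46) pp.266-267; King1986, Prop. 3.8-3.9 pp.664-665] -/
theorem twoRunMinT_of_sloppy {D : AlphaDataT3 F γ} {PT : TermFn F} {b₀ p₀ κ κ₀ b s C C' C_A C_B : ℝ}
    (hs0 : 0 ≤ s) (hs1 : s ≤ 1) (hC : 0 ≤ C) (hCA : 0 ≤ C_A) (hCB : 0 ≤ C_B) (hθ : ∀ n, 0 < θBal F.L γ b₀ p₀ n)
    (hκ'0 : 0 < (1 - s) * κ + s * κ₀) (hκ'le : (1 - s) * κ + s * κ₀ ≤ κ)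
    (hT : TermSizeTrivT D PT b₀ p₀ C κ) (hA : PairSizeT D PT b₀ p₀ κ C_A)
    (hcov : LocCover D ((1 - s) * κ + s * κ₀) C') (hvol : LocBlockVolume D) (hM : LocMatched D)
    (hB : PolymerCauchyMinAtT D PT b₀ p₀ κ₀ b C_B) :
    TwoRunMinT D PT b₀ p₀ (s * b) :=
  ⟨(1 - s) * κ + s * κ₀, ⟨C, termSizeTrivT_mono hC hT hκ'0 hκ'le hcov.1⟩, ⟨C', hcov⟩, hvol, hM,
    ⟨(4 * C_A) ^ (1 - s) * (2 * C_B) ^ s, polymerCauchyMinAtT_squeeze hs0 hs1 hCA hCB hθ hA hB⟩⟩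

/-- The same for the §3 bundle `TwoRunMin` (the form STUB 3′ of line v5h and `landed_levelCauchyOfTwoRunMin` read), with the matched-pair size DERIVED from print's
size row via `LocMatched`, `TreeLenMatched` and the threshold window `√γ ≤ e^{1−p₀}` (`T3Thresholds.θBal_succ_le`); `θ(n) > 0` from
`T3MinimiserStabilityReduction.θBal_pos`.  Inputs: `1 ≤ F.L`, `0 < γ ≤ 1`, `√γ ≤ e^{1−p₀}`, `0 < b₀`, `0 ≤ p₀`.
[cite: Balaban1985UV3, (43)-(46) pp.266-267; King1986, Prop. 3.8-3.9 pp.664-665] -/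
theorem twoRunMin_of_sloppy {D : AlphaDataT3 F γ} {b₀ p₀ κ κ₀ b s C C' C_B : ℝ}
    (hL : 1 ≤ F.L) (hγ : 0 < γ) (hγ1 : γ ≤ 1) (hγe : Real.sqrt γ ≤ Real.exp (1 - p₀)) (hb₀ : 0 < b₀) (hp₀ : 0 ≤ p₀)
    (hs0 : 0 ≤ s) (hs1 : s ≤ 1) (hC : 0 ≤ C) (hCB : 0 ≤ C_B)
    (hκ'0 : 0 < (1 - s) * κ + s * κ₀) (hκ'le : (1 - s) * κ + s * κ₀ ≤ κ)
    (hT : TermSizeTriv D b₀ p₀ C κ) (hℓ : TreeLenMatched D)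
    (hcov : LocCover D ((1 - s) * κ + s * κ₀) C') (hvol : LocBlockVolume D) (hM : LocMatched D)
    (hB : PolymerCauchyMinAt D b₀ p₀ κ₀ b C_B) :
    TwoRunMin D b₀ p₀ (s * b) := by
  have hθ : ∀ n, 0 < θBal F.L γ b₀ p₀ n := fun n => T3MinimiserStabilityReduction.θBal_pos hL hγ hγ1 hb₀ p₀ n
  have hA : PairSizeT D (ptermMin D) b₀ p₀ κ C :=
    pairSizeT_of_termSizeTrivT hC ((termSizeTrivT_ptermMin_iff D b₀ p₀ C κ).mpr hT) hM hℓ (fun n => (hθ (n + 1)).le)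
      (fun n => T3Thresholds.θBal_succ_le hL hγ hγ1 hγe hb₀.le hp₀ n)
  exact (twoRunMinT_ptermMin_iff D b₀ p₀ _).mp
    (twoRunMinT_of_sloppy hs0 hs1 hC hC hCB hθ hκ'0 hκ'le ((termSizeTrivT_ptermMin_iff D b₀ p₀ C κ).mpr hT) hA hcov hvol hM
      ((polymerCauchyMinAtT_ptermMin_iff D b₀ p₀ κ₀ b C_B).mpr hB))

/-! ## §5 The prover's entry point: a decay-free row from per-constituent comparisons and a constituent COUNT -/

/-- **A DECAY-FREE TWO-RUN ROW FROM CONSTITUENTS** (sorry-free): if the term function is a finite sum of constituents with refinement-matched labels,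
`PT K j i Y W = Σ_{ω ∈ S K i Y} t K j i Y ω W`, `S (K+1) (i+1) (refineSet Y) = S K i Y`, the labels of a level-`i` domain number at most `e^{p𝓛_K(Y)}`, and each
matched constituent pair is compared on the window at exponent `b` with NO decay (`|t′ − t − c_ω| ≤ C·θ(n)²·L^{−4(k−i)}·(L^{−i})^{b}`), then the two-run row holds at
rate `κ₀ = −p` (growth `e^{p𝓛}`), exponent `b`, constant `C` — the input of `polymerCauchyMinAtT_squeeze` ∕ `twoRunMinT_of_sloppy`.
[cite: Balaban1985UV3, (24)-(25) p.262; King1986, Prop. 3.9 p.665] -/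
theorem polymerCauchyMinAtT_of_constituents {ι : Type*} {D : AlphaDataT3 F γ} {PT : TermFn F} {b₀ p₀ p b C : ℝ}
    (S : (K i : ℕ) → Set (Site (F.P K) 0) → Finset ι)
    (t : (K j i : ℕ) → Set (Site (F.P K) 0) → ι → GaugeField (F.P K) j (Matrix.specialUnitaryGroup (Fin 2) ℂ) → ℝ)
    (hC : 0 ≤ C)
    (hsum : ∀ (K j i : ℕ) (Y : Set (Site (F.P K) 0)) (W : GaugeField (F.P K) j (Matrix.specialUnitaryGroup (Fin 2) ℂ)),
      PT K j i Y W = ∑ ω ∈ S K i Y, t K j i Y ω W)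
    (hmatch : ∀ (K i : ℕ) (Y : Set (Site (F.P K) 0)), S (K + 1) (i + 1) (refineSet F K Y) = S K i Y)
    (hcard : ∀ (K i : ℕ) (Y : Set (Site (F.P K) 0)), ((S K i Y).card : ℝ) ≤ Real.exp (p * D.treeLen K i Y))
    (hcomp : ∃ c : (K n j : ℕ) → Set (Site (F.P K) 0) → ι → ℝ,
      ∀ (K n : ℕ) (h : n ≤ K), ∀ j : ℕ, j < K - n →
        ∀ V : GaugeField (F.P n) 0 (Matrix.specialUnitaryGroup (Fin 2) ℂ), PlaqSmall (θBal F.L γ b₀ p₀ n) V →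
          ∀ Y ∈ D.Loc K (K - n) (D.triv K (K - n)) (1 + j), ∀ ω ∈ S K (1 + j) Y,
            |t (K + 1) (K + 1 - n) (1 + (j + 1)) (refineSet F K Y) ω
                (fieldShift (F.sitesPerDir_eq (m := F.m) (K := K + 1) (j := K + 1 - n) (m' := F.m) (K' := n) (j' := 0) (by omega)) V) -
              t K (K - n) (1 + j) Y ω
                (fieldShift (F.sitesPerDir_eq (m := F.m) (K := K) (j := K - n) (m' := F.m) (K' := n) (j' := 0) (by omega)) V) -
              c K n j Y ω| ≤
            C * θBal F.L γ b₀ p₀ n ^ 2 * (((F.L : ℝ) ^ (K - n - 1 - j))⁻¹) ^ 4 * (((F.L : ℝ) ^ (1 + j))⁻¹) ^ b) :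
    PolymerCauchyMinAtT D PT b₀ p₀ (-p) b C := by
  obtain ⟨c, hc⟩ := hcomp
  refine ⟨fun K n j Y => ∑ ω ∈ S K (1 + j) Y, c K n j Y ω, ?_⟩
  intro K n h j hj V hV Y hY
  have hm : S (K + 1) (1 + (j + 1)) (refineSet F K Y) = S K (1 + j) Y := hmatch K (1 + j) Y
  rw [hsum (K + 1) (K + 1 - n) (1 + (j + 1)) (refineSet F K Y), hsum K (K - n) (1 + j) Y, hm,
    ← Finset.sum_sub_distrib, ← Finset.sum_sub_distrib]
  have hB : 0 ≤ C * θBal F.L γ b₀ p₀ n ^ 2 * (((F.L : ℝ) ^ (K - n - 1 - j))⁻¹) ^ 4 * (((F.L : ℝ) ^ (1 + j))⁻¹) ^ b :=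
    mul_nonneg (by positivity) (Real.rpow_nonneg (by positivity) b)
  calc |∑ ω ∈ S K (1 + j) Y, (t (K + 1) (K + 1 - n) (1 + (j + 1)) (refineSet F K Y) ω
            (fieldShift (F.sitesPerDir_eq (m := F.m) (K := K + 1) (j := K + 1 - n) (m' := F.m) (K' := n) (j' := 0) (by omega)) V) -
          t K (K - n) (1 + j) Y ω
            (fieldShift (F.sitesPerDir_eq (m := F.m) (K := K) (j := K - n) (m' := F.m) (K' := n) (j' := 0) (by omega)) V) -
          c K n j Y ω)|
        ≤ ∑ ω ∈ S K (1 + j) Y, |t (K + 1) (K + 1 - n) (1 + (j + 1)) (refineSet F K Y) ω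
            (fieldShift (F.sitesPerDir_eq (m := F.m) (K := K + 1) (j := K + 1 - n) (m' := F.m) (K' := n) (j' := 0) (by omega)) V) -
          t K (K - n) (1 + j) Y ω
            (fieldShift (F.sitesPerDir_eq (m := F.m) (K := K) (j := K - n) (m' := F.m) (K' := n) (j' := 0) (by omega)) V) -
          c K n j Y ω| := Finset.abs_sum_le_sum_abs _ _
    _ ≤ ∑ ω ∈ S K (1 + j) Y, C * θBal F.L γ b₀ p₀ n ^ 2 * (((F.L : ℝ) ^ (K - n - 1 - j))⁻¹) ^ 4 * (((F.L : ℝ) ^ (1 + j))⁻¹) ^ b :=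
          Finset.sum_le_sum fun ω hω => hc K n h j hj V hV Y hY ω hω
    _ = ((S K (1 + j) Y).card : ℝ) * (C * θBal F.L γ b₀ p₀ n ^ 2 * (((F.L : ℝ) ^ (K - n - 1 - j))⁻¹) ^ 4 * (((F.L : ℝ) ^ (1 + j))⁻¹) ^ b) := by
          rw [Finset.sum_const, nsmul_eq_mul]
    _ ≤ Real.exp (p * D.treeLen K (1 + j) Y) *
          (C * θBal F.L γ b₀ p₀ n ^ 2 * (((F.L : ℝ) ^ (K - n - 1 - j))⁻¹) ^ 4 * (((F.L : ℝ) ^ (1 + j))⁻¹) ^ b) :=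
          mul_le_mul_of_nonneg_right (hcard K (1 + j) Y) hB
    _ = C * Real.exp (-(-p) * D.treeLen K (1 + j) Y) * θBal F.L γ b₀ p₀ n ^ 2 * (((F.L : ℝ) ^ (K - n - 1 - j))⁻¹) ^ 4 *
          (((F.L : ℝ) ^ (1 + j))⁻¹) ^ b := by rw [neg_neg]; ring

end Summit.QuantumFields.YangMills.Cruxes.FluctuationComparisonRegPr.Ideate1Squeeze

end
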